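import Literature.AlgebraicGeometry.RelativeSpec.GeometricQuotientGroupLaw
import Mathlib.AlgebraicGeometry.Pullbacks
import Mathlib.AlgebraicGeometry.Morphisms.Finite
import Mathlib.AlgebraicGeometry.Morphisms.Separated
import Mathlib.CategoryTheory.Limits.Constructions.Over.Connected
import HarnessLib

/-!
# The GLOBAL TORSOR SQUARE and the GLOBAL PROPERTIES of a charted quotient `π : X → Q = X⧸G` by a finite flat group scheme
# ([MumfordAV1970] §12 Thm. 1; [SGA3I] Exp. V Thm. 4.1) — «`IsPullback` is local on the base», chart-data form

Layer `Literature/AlgebraicGeometry/RelativeSpec`, namespace `Literature.AlgebraicGeometry.RelativeSpec.TorsorQuotientGlobal`.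
THEOREMS ONLY (no definition, no named fact, no instance, no notation, no `sorry`).

THE PRINT.  [MumfordAV1970] §12 Thm. 1 (pp. 111–115): for a finite (flat) group scheme `G` acting freely on `X` such that every orbit lies in an
affine open, the quotient `π : X → Y = X⧸G` exists, `π` is finite, faithfully flat, and (A) `G × X ≅ X ×_Y X`.  The PROOF (p. 112 ff.; [SGA3I] Exp. V
§4 Thm. 4.1, §5) constructs `Y` by GLUING the affine quotients `Spec (𝒪(U)^G)` of `G`-stable affine opens `U` and verifies finiteness ∕ flatness ∕
the torsor isomorphism ON EACH CHART.  This file is the passage «chartwise ⇒ global» of that proof, typed for an ABSTRACT charted quotient so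
that the gluing step (census Q5c) feeds it its charts as DATA:

* §0 **`isPullback_of_openCover_of_charts`** — «a commutative square over a base `Q` is cartesian if it is cartesian over the members of an open
  cover of `Q`», with the four corners over each member given as `IsPullback` DATA (Mathlib `Scheme.isPullback_of_openCover` is locality on a CORNER;
  we re-index the cover through the charts and transport along `IsPullback.isoPullback`); the seam `isPullback_of_left` ∕ `isPullback_left` between
  squares in `Over S` and squares of underlying schemes (`Over.forget` creates connected limits).
* §1 (census Q7) **`isPullback_act_snd_left`**, **`isPullback_act_snd`** — THE GLOBAL TORSOR SQUARE `(act, pr₂) : G ⊗ X ≅ X ×_Q X` (on underlying schemes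
  and in `Over S`) from the chart torsor squares `G ⊗ O_j ≅ O_j ×_{𝒰_j} O_j` over an open cover `𝒰` of `Q` with `O_j = π⁻¹(𝒰_j)` `G`-stable.
* §2 (census Q6) **`of_isPullback_charts`** — a property local on the target holds for `π` if it holds for the chart maps `O_j → 𝒰_j`; hence
  `isFinite_of_charts`, `flat_of_charts`, `surjective_of_charts`, `quasiCompact_of_charts`; `locallyOfFiniteType_of_charts` for `Q → S` (local at the source).
* §3 (census Q6, separatedness) **`isSeparated_of_isPullback_of_isClosedImmersion`** — `Q → S` is SEPARATED when `π` is surjective and universally closed, the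
  torsor square holds and the shear `(act, pr₂) : G ⊗ X → X ⊗_S X` is a closed immersion (free action of a finite group scheme, [MumfordFogartyKirwan1994]
  Def. 0.8 (iv)): the diagonal of `Q` pulls back along `π × π` to the shear (`isPullback_lift_act_snd_diag`, pure category theory), `π × π` is surjective and
  closed (`surjective_universallyClosed_tensorHom_left`), so `Δ_Q(Q)` is closed.
* §4 **the CHARTED-QUOTIENT-DATUM interface** (`…_of_chartedQuotient`): the same conclusions from the chart-square form of the gluing output — for every `j`
  a `G`-stable affine open `U j ⊆ X` with a lift `a j` of the action, an affine chart `ιQ j : QU j ↪ Q` (open immersions, jointly surjective) with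
  `U j = X ×_Q QU j`, and a finite flat surjective `q j : U j → QU j` over it with cartesian torsor square — the hypothesis block is the output of the
  locally directed gluing (census Q5c, «CQD TOKEN v2» of LH6-p04 (g14)) TOKEN FOR TOKEN with `act` for `γ[G, X]`.

No group structure on `G` is used anywhere (only the maps `act`, `pr₂`, `π` and the charts).  Cell hodgecm-mathlib (D-0151 ∕ D-0183 FLOOR 0), P6b «σ2» socket §Q
`stub_L4B1uQ_quotientByFiniteFlatSubgroup`, wave-B row (8) QB4′-P «SPINE: global torsor square + global properties» of DEALS v8 (CENSUS-Q-junction v1, LH10-p01 (g17));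
prover «LH5» LH5-p02 (g14).  Consumers: (4) ★ `GroupSchemes/GroupLawDescendsAlongTorsorQuotient` and (5) ★ `GroupSchemes/TorsorQuotientKernelOnPoints` (the `Over S`
square `hsq`), (6) ★ `AbelianSchemes/AbelianSchemeOfFlatSurjectiveImage` (`IsFinite ∕ Flat ∕ Surjective π.left`, `IsSeparated ∕ LocallyOfFiniteType Q.hom`).  Generic,
count-neutral capital on `--supports stmt-HodgeConjecture-24832`; HC_CM is proved only modulo the printed citations until rung 0 closes; nothing here is about HC.

## References
* [MumfordAV1970] D. Mumford, *Abelian Varieties* (1970), §12 Thm. 1 and its proof (pp. 111–115).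
* [SGA3I] M. Demazure, A. Grothendieck, *SGA 3* Tome I (LNM 151), Exp. V §4 Thm. 4.1, §5.
* [MumfordFogartyKirwan1994] D. Mumford, J. Fogarty, F. Kirwan, *Geometric Invariant Theory*, 3rd ed. (1994), Ch. 0 §3 Def. 0.8 (pp. 9–10).
* [GortzWedhorn2020] U. Görtz, T. Wedhorn, *Algebraic Geometry I* (2nd ed., 2020), Section (4.7) (pp. 107–108) (base change), Def. 9.7 ∕ Prop. 9.10 (separated).
* [SGA1] A. Grothendieck, M. Raynaud, *SGA 1* (LNM 224), Exp. V §1 (fibre products of `S`-schemes with group action).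
-/

noncomputable section

set_option backward.isDefEq.respectTransparency false

universe u

open CategoryTheory CategoryTheory.Limits AlgebraicGeometry MonoidalCategory CartesianMonoidalCategory

namespace Literature.AlgebraicGeometry.RelativeSpec.TorsorQuotientGlobal

/-! ### §0 `IsPullback` is local on the base (chart-data form); squares in `Over S` from squares of schemes -/

/-- **A commutative square of schemes over a base `Q` is CARTESIAN as soon as it is cartesian over the members of an open cover of `Q`**,
chart-data form: `a, s : P → X`, `π : X → Q` with `a ≫ π = s ≫ π`; `𝒰` an open cover of `Q`; for every `j` a chart `O j → X` which IS
`π⁻¹(𝒰_j)` (`hO`, cartesian), a chart `PO j → P` which IS `s⁻¹(O j)` (`hP`, cartesian) with `a` restricting to `aO j` (`haO`), and the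
chart square `(aO j, sO j)` over `q j : O j → 𝒰_j` cartesian (`hc`) — THEN `(a, s)` is cartesian over `(π, π)`.  (Mathlib
`Scheme.isPullback_of_openCover` = locality on a CORNER; here the cover lives on the BASE and the corners are given as DATA, so that
invariant charts of a group action plug in without `morphismRestrict` bookkeeping.) [cite: MumfordAV1970, §12 Thm. 1 (pp. 111–112)]
[cite: SGA3I, Exp. V Thm. 4.1] -/
theorem isPullback_of_openCover_of_charts {P X Q : Scheme.{u}} (a s : P ⟶ X) (π : X ⟶ Q) (w : a ≫ π = s ≫ π)
    (𝒰 : Q.OpenCover) {O PO : 𝒰.I₀ → Scheme.{u}} (ιO : ∀ j, O j ⟶ X) (q : ∀ j, O j ⟶ 𝒰.X j)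
    (hO : ∀ j, IsPullback (ιO j) (q j) π (𝒰.f j)) (ιP : ∀ j, PO j ⟶ P) (aO sO : ∀ j, PO j ⟶ O j)
    (haO : ∀ j, ιP j ≫ a = aO j ≫ ιO j) (hP : ∀ j, IsPullback (ιP j) (sO j) s (ιO j))
    (hc : ∀ j, IsPullback (aO j) (sO j) (q j) (q j)) : IsPullback a s π π := by
  -- the charts `O j` form an open cover of `X`
  haveI : ∀ j, IsOpenImmersion (ιO j) := fun j =>
    MorphismProperty.of_isPullback (P := @IsOpenImmersion) (hO j).flip (𝒰.map_prop j)
  let 𝒪 : X.OpenCover := Scheme.Cover.mkOfCovers 𝒰.I₀ O ιO (fun x => by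
    obtain ⟨j, y, hy⟩ := 𝒰.exists_eq (π x)
    obtain ⟨z, hz, -⟩ := Scheme.Pullback.exists_preimage_pullback (f := π) (g := 𝒰.f j) x y hy.symm
    refine ⟨j, (hO j).isoPullback.inv z, ?_⟩
    rw [← Scheme.Hom.comp_apply, IsPullback.isoPullback_inv_fst]
    exact hz) inferInstance
  refine Scheme.isPullback_of_openCover a s π π 𝒪 fun j => ?_
  -- over the chart `O j`: `PO j` IS `a⁻¹ (O j)` too (from `hP`, `hO`, `w`, `haO`)
  have hPa : IsPullback (ιP j) (aO j) a (ιO j) := by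
    have big : IsPullback (ιP j) (aO j ≫ q j) (a ≫ π) (𝒰.f j) := by
      rw [(hc j).w, w]; exact (hP j).paste_vert (hO j)
    exact big.of_bot (haO j) (hO j)
  -- the chart square pasted with `hO`: `PO j → O j` over `X → Q` is cartesian
  have D : IsPullback (aO j) (ιP j ≫ s) (ιO j ≫ π) π := by
    rw [(hP j).w, (hO j).w]; exact ((hc j).flip.paste_horiz (hO j)).flip
  -- transport the top-left corner to Mathlib's `pullback a (ιO j)`
  change IsPullback (pullback.snd a (ιO j)) (pullback.fst a (ιO j) ≫ s) (ιO j ≫ π) π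
  exact D.of_iso hPa.isoPullback (Iso.refl _) (Iso.refl _) (Iso.refl _)
    (by rw [Iso.refl_hom, Category.comp_id, hPa.isoPullback_hom_snd])
    (by rw [Iso.refl_hom, Category.comp_id, ← Category.assoc, hPa.isoPullback_hom_fst]) (by simp) (by simp)

/-- **A square in `Over S` is cartesian iff its square of underlying schemes is** (`Over.forget S` creates connected limits — Mathlib; the
direction «schemes ⇒ `Over S`»).  This is the seam between the scheme-level torsor square (`.left` currency, consumed by descent along
`π.left`) and the `Over S`-level one (consumed by `T`-valued points in `Over S`). [cite: SGA3I, Exp. V Thm. 4.1] -/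
theorem isPullback_of_left {S : Scheme.{u}} {W X Y Z : Over S} {f : W ⟶ X} {g : W ⟶ Y} {h : X ⟶ Z} {i : Y ⟶ Z}
    (H : IsPullback f.left g.left h.left i.left) : IsPullback f g h i :=
  IsPullback.of_map (Over.forget S) (Over.OverMorphism.ext (by simpa using H.w)) H

/-- … and the direction «`Over S` ⇒ schemes» (`Over.forget S` preserves pullbacks). [cite: SGA3I, Exp. V Thm. 4.1] -/
theorem isPullback_left {S : Scheme.{u}} {W X Y Z : Over S} {f : W ⟶ X} {g : W ⟶ Y} {h : X ⟶ Z} {i : Y ⟶ Z}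
    (H : IsPullback f g h i) : IsPullback f.left g.left h.left i.left :=
  H.map (Over.forget S)


/-! ### §1 The GLOBAL TORSOR SQUARE of a charted quotient (Q7) -/

section Charted

variable {S : Scheme.{u}} {G X Q : Over S} (act : G ⊗ X ⟶ X) (π : X ⟶ Q) (w : act ≫ π = snd G X ≫ π)
  (𝒰 : Q.left.OpenCover) (O : 𝒰.I₀ → Over S) (ιO : ∀ j, O j ⟶ X) (aO : ∀ j, G ⊗ O j ⟶ O j)
  (haO : ∀ j, aO j ≫ ιO j = (G ◁ ιO j) ≫ act) (q : ∀ j, (O j).left ⟶ 𝒰.X j)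
  (hO : ∀ j, IsPullback (ιO j).left (q j) π.left (𝒰.f j))
  (hc : ∀ j, IsPullback (aO j).left (snd G (O j)).left (q j) (q j))

include w haO hO hc in
/-- **THE GLOBAL TORSOR SQUARE, underlying schemes** (Q7).  `G, X, Q` over `S`, an «action» map `act : G ⊗ X → X` and `π : X → Q` with
`act ≫ π = pr₂ ≫ π`; an open cover `𝒰` of `Q` and, over each member, a CHART: `ιO j : O j → X` with `O j = π⁻¹(𝒰_j)` (`hO`), a restricted action
`aO j : G ⊗ O j → O j` (`haO : aO j ≫ ιO j = (G ◁ ιO j) ≫ act`, the invariance of the chart — ★ `ActionRestrict.liftOpen_comp`'s shape) and the CHART TORSOR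
SQUARE `G ⊗ O j ≅ O j ×_{𝒰_j} O j` (`hc`, e.g. ★ `FiniteFlatQuotientAffine.torsorOverInvariants` on an affine chart).  THEN the global square is cartesian:
`(act, pr₂) : G ⊗ X ≅ X ×_Q X` on underlying schemes — [MumfordAV1970] §12 Thm. 1 (A) «`G × X ≅ X ×_Y X`» globalised from the `G`-stable affine
charts (`isPullback_of_openCover_of_charts`; the corner `G ⊗ O j = pr₂⁻¹(O j)` is the cartesian square of the whiskering, ★ `isPullback_whiskerLeft_left`).
[cite: MumfordAV1970, §12 Theorem 1 (A) and its proof (pp. 111–115)] [cite: SGA3I, Exp. V Thm. 4.1] -/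
theorem isPullback_act_snd_left : IsPullback act.left (snd G X).left π.left π.left := by
  refine isPullback_of_openCover_of_charts act.left (snd G X).left π.left (by rw [← Over.comp_left, w, Over.comp_left]) 𝒰
    (fun j => (ιO j).left) q hO (fun j => (G ◁ ιO j).left) (fun j => (aO j).left) (fun j => (snd G (O j)).left)
    (fun j => by rw [← Over.comp_left, ← haO j, Over.comp_left]) (fun j => ?_) hc
  rw [Over.snd_left, Over.snd_left]
  exact (ActionOver.IsGeometricQuotient.isPullback_whiskerLeft_left (ιO j) G).flip

include w haO hO hc in
/-- **THE GLOBAL TORSOR SQUARE in `Over S`** (Q7, the currency of `T`-valued points): `IsPullback act (snd G X) π π` — the `hsq` token consumed by the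
descent of the group law (Q8) and by the kernel-on-points computation (Q9). [cite: MumfordAV1970, §12 Theorem 1 (A) (pp. 111–115)] [cite: SGA3I, Exp. V Thm. 4.1] -/
theorem isPullback_act_snd : IsPullback act (snd G X) π π :=
  isPullback_of_left (isPullback_act_snd_left act π w 𝒰 O ιO aO haO q hO hc)

end Charted

/-! ### §2 GLOBAL PROPERTIES of the quotient map and of the quotient (Q6) -/

section Local

variable {X Q : Scheme.{u}} (π : X ⟶ Q) (𝒰 : Q.OpenCover) {O : 𝒰.I₀ → Scheme.{u}} (ιO : ∀ j, O j ⟶ X) (q : ∀ j, O j ⟶ 𝒰.X j)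
  (hO : ∀ j, IsPullback (ιO j) (q j) π (𝒰.f j))

include hO in
/-- **A property local on the target holds for `π : X → Q` if it holds for the CHART maps `q j : O j = π⁻¹(𝒰_j) → 𝒰_j`** of an open cover `𝒰` of `Q`
(charts as `IsPullback` data; Mathlib `IsZariskiLocalAtTarget.of_openCover` after transport along `O j ≅ X ×_Q 𝒰_j`). [cite: SGA3I, Exp. V Thm. 4.1]
[cite: GortzWedhorn2020, Section (4.7) (pp. 107–108)] -/
theorem of_isPullback_charts {P : MorphismProperty Scheme.{u}} [IsZariskiLocalAtTarget P] (h : ∀ j, P (q j)) : P π := by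
  refine IsZariskiLocalAtTarget.of_openCover 𝒰 fun j => ?_
  change P (pullback.snd π (𝒰.f j))
  rw [← (hO j).isoPullback_inv_snd, P.cancel_left_of_respectsIso]
  exact h j

include hO in
/-- `π` is FINITE if the chart maps are (e.g. ★ `finite_faithfullyFlat_invariants` on affine charts). [cite: MumfordAV1970, §12 Theorem 1 (pp. 111–115)] -/
theorem isFinite_of_charts (h : ∀ j, IsFinite (q j)) : IsFinite π := of_isPullback_charts π 𝒰 ιO q hO h

include hO in
/-- `π` is FLAT if the chart maps are. [cite: MumfordAV1970, §12 Theorem 1 (pp. 111–115)] -/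
theorem flat_of_charts (h : ∀ j, Flat (q j)) : Flat π := of_isPullback_charts π 𝒰 ιO q hO h

include hO in
/-- `π` is SURJECTIVE if the chart maps are. [cite: MumfordAV1970, §12 Theorem 1 (pp. 111–115)] -/
theorem surjective_of_charts (h : ∀ j, Surjective (q j)) : Surjective π := of_isPullback_charts π 𝒰 ιO q hO h

include hO in
/-- `π` is QUASI-COMPACT if the chart maps are (automatic for finite charts). [cite: MumfordAV1970, §12 Theorem 1 (pp. 111–115)] -/
theorem quasiCompact_of_charts (h : ∀ j, QuasiCompact (q j)) : QuasiCompact π := of_isPullback_charts π 𝒰 ιO q hO h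

/-- **The quotient is LOCALLY OF FINITE TYPE over the base if its charts are** (Mathlib: local at the source; e.g. ★ `finiteType_invariants` for the affine
charts `Spec (C^G)` over a Noetherian base). [cite: MumfordAV1970, §12 Theorem 1 (pp. 111–115)] [cite: SGA3I, Exp. V Thm. 4.1] -/
theorem locallyOfFiniteType_of_charts {S : Scheme.{u}} (f : Q ⟶ S) (h : ∀ j, LocallyOfFiniteType (𝒰.f j ≫ f)) : LocallyOfFiniteType f :=
  IsZariskiLocalAtSource.of_openCover 𝒰 h

end Local

/-! ### §3 The quotient is SEPARATED: the diagonal of `Q` pulls back to the closed `(act, pr₂) : G ⊗ X ↪ X ⊗ X` -/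

section Separated

variable {S : Scheme.{u}} {G X Q : Over S} (act : G ⊗ X ⟶ X) (π : X ⟶ Q)

/-- Points of the top-left corner of a cartesian square of schemes map ONTO the preimage of the range of the bottom map (Mathlib
`Scheme.Pullback.range_snd`, transported along `IsPullback.isoPullback`). [cite: GortzWedhorn2020, Section (4.7) (pp. 107–108)] -/
theorem range_snd_of_isPullback {P X Y Z : Scheme.{u}} {fst : P ⟶ X} {snd : P ⟶ Y} {f : X ⟶ Z} {g : Y ⟶ Z}
    (H : IsPullback fst snd f g) : Set.range snd = g ⁻¹' Set.range f := by
  rw [← H.isoPullback_hom_snd, Scheme.Hom.comp_base, TopCat.coe_comp, Set.range_comp,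
    show Set.range ⇑H.isoPullback.hom = Set.univ from Set.range_eq_univ.mpr H.isoPullback.hom.homeomorph.surjective, Set.image_univ]
  exact Scheme.Pullback.range_snd f g

/-- **The diagonal of the quotient pulls back to the shear**: from the torsor square `IsPullback act pr₂ π π`, the square
`G ⊗ X →(act, pr₂) X ⊗ X →(π ⊗ π) Q ⊗ Q ←(Δ) Q` (left leg `pr₂ ≫ π`) is cartesian — `X ×_Q X = (X ×_S X) ×_{Q ×_S Q} Q` (pure category theory in
`Over S`). [cite: MumfordFogartyKirwan1994, Ch. 0 §3, Def. 0.8 (pp. 9–10)] [cite: SGA3I, Exp. V Thm. 4.1] -/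
theorem isPullback_lift_act_snd_diag (hsq : IsPullback act (snd G X) π π) :
    IsPullback (lift act (snd G X)) (snd G X ≫ π) (π ⊗ₘ π) (lift (𝟙 Q) (𝟙 Q)) := by
  have comm : lift act (snd G X) ≫ (π ⊗ₘ π) = (snd G X ≫ π) ≫ lift (𝟙 Q) (𝟙 Q) := by
    refine CartesianMonoidalCategory.hom_ext _ _ ?_ ?_
    · simp only [Category.assoc, tensorHom_fst, lift_fst_assoc, lift_fst, Category.comp_id]; exact hsq.w
    · simp only [Category.assoc, tensorHom_snd, lift_snd_assoc, lift_snd, Category.comp_id]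
  refine IsPullback.of_isLimit' ⟨comm⟩ (PullbackCone.IsLimit.mk _
    (fun c => hsq.lift (c.fst ≫ fst X X) (c.fst ≫ snd X X) ?_) (fun c => ?_) (fun c => ?_) (fun c m hm₁ hm₂ => ?_))
  · -- the two components of a cone agree after `π`: both are `c.snd`
    have h1 := congrArg (· ≫ fst Q Q) c.condition
    have h2 := congrArg (· ≫ snd Q Q) c.condition
    simp only [Category.assoc, tensorHom_fst, tensorHom_snd, lift_fst, lift_snd, Category.comp_id] at h1 h2
    rw [Category.assoc, Category.assoc, h1, h2]
  · refine CartesianMonoidalCategory.hom_ext _ _ ?_ ?_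
    · simp only [Category.assoc, lift_fst, IsPullback.lift_fst]
    · simp only [Category.assoc, lift_snd, IsPullback.lift_snd]
  · have h2 := congrArg (· ≫ snd Q Q) c.condition
    simp only [Category.assoc, tensorHom_snd, lift_snd, Category.comp_id] at h2
    rw [← Category.assoc, hsq.lift_snd, Category.assoc, h2]
  · refine hsq.hom_ext ?_ ?_
    · rw [hsq.lift_fst, ← hm₁, Category.assoc, lift_fst]
    · rw [hsq.lift_snd, ← hm₁, Category.assoc, lift_snd]

/-- `(lift (𝟙 Q) (𝟙 Q)).left` IS Mathlib's diagonal of `Q → S` (both are `Q → Q ×_S Q` with identity components). [cite: GortzWedhorn2020, Section (4.7) (pp. 107–108)] -/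
theorem lift_id_id_left (Q : Over S) : (lift (𝟙 Q) (𝟙 Q)).left = pullback.diagonal Q.hom := by
  rw [Over.lift_left]
  apply pullback.hom_ext
  · rw [pullback.lift_fst, pullback.diagonal_fst]; rfl
  · rw [pullback.lift_snd, pullback.diagonal_snd]; rfl

/-- `(π ⊗ₘ π).left` is SURJECTIVE and UNIVERSALLY CLOSED when `π.left` is (two base changes of `π.left`, ★ `isPullback_whiskerRight_left` ∕
`isPullback_whiskerLeft_left`, composed). [cite: SGA1, Exp. V §1] -/
theorem surjective_universallyClosed_tensorHom_left [Surjective π.left] [UniversallyClosed π.left] :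
    Surjective (π ⊗ₘ π).left ∧ UniversallyClosed (π ⊗ₘ π).left := by
  have e : (π ⊗ₘ π).left = (π ▷ X).left ≫ (Q ◁ π).left := by rw [tensorHom_def, Over.comp_left]
  haveI : Surjective (π ▷ X).left :=
    MorphismProperty.of_isPullback (ActionOver.IsGeometricQuotient.isPullback_whiskerRight_left π X) ‹Surjective π.left›
  haveI : UniversallyClosed (π ▷ X).left :=
    MorphismProperty.of_isPullback (ActionOver.IsGeometricQuotient.isPullback_whiskerRight_left π X) ‹UniversallyClosed π.left›
  haveI : Surjective (Q ◁ π).left :=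
    MorphismProperty.of_isPullback (ActionOver.IsGeometricQuotient.isPullback_whiskerLeft_left π Q) ‹Surjective π.left›
  haveI : UniversallyClosed (Q ◁ π).left :=
    MorphismProperty.of_isPullback (ActionOver.IsGeometricQuotient.isPullback_whiskerLeft_left π Q) ‹UniversallyClosed π.left›
  rw [e]
  exact ⟨inferInstance, inferInstance⟩

/-- **THE QUOTIENT IS SEPARATED over `S`** (Q6, separatedness): if `π.left` is surjective and universally closed (e.g. finite), the torsor square
`IsPullback act pr₂ π π` holds and the «shear» `(act, pr₂) : G ⊗ X → X ⊗_S X` is a CLOSED immersion on underlying schemes (a FREE action of a finite,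
hence proper, group scheme — [MumfordFogartyKirwan1994] Def. 0.8 (iv); the §Q organ (g1)), then `Q → S` is separated: `(π × π)⁻¹(Δ_Q) = image of the
shear` is closed, `π × π` is surjective and closed, so `Δ_Q(Q) = (π × π)((π × π)⁻¹ Δ_Q)` is closed, and the diagonal immersion is a closed immersion.
[cite: MumfordAV1970, §12 Theorem 1 and its proof (pp. 111–115)] [cite: MumfordFogartyKirwan1994, Ch. 0 §3, Def. 0.8 (pp. 9–10)] [cite: SGA3I, Exp. V Thm. 4.1] -/
theorem isSeparated_of_isPullback_of_isClosedImmersion [Surjective π.left] [UniversallyClosed π.left] (hsq : IsPullback act (snd G X) π π)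
    (hfree : IsClosedImmersion (lift act (snd G X)).left) : IsSeparated Q.hom := by
  obtain ⟨hsurj, hcl⟩ := surjective_universallyClosed_tensorHom_left π
  -- `(π × π)⁻¹ (range Δ_Q) = range (act, pr₂)`, closed
  have hD := isPullback_left (isPullback_lift_act_snd_diag act π hsq)
  rw [lift_id_id_left] at hD
  have hrange : ((π ⊗ₘ π).left) ⁻¹' Set.range (pullback.diagonal Q.hom) = Set.range (lift act (snd G X)).left :=
    (range_snd_of_isPullback hD.flip).symm
  have hclosed : IsClosed (Set.range ⇑(pullback.diagonal Q.hom)) := by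
    have himg : (π ⊗ₘ π).left '' (((π ⊗ₘ π).left) ⁻¹' Set.range (pullback.diagonal Q.hom)) = Set.range (pullback.diagonal Q.hom) :=
      Set.image_preimage_eq _ hsurj.surj
    rw [← himg, hrange]
    exact (π ⊗ₘ π).left.isClosedMap _ (lift act (snd G X)).left.isClosedEmbedding.isClosed_range
  haveI : IsClosedImmersion (pullback.diagonal Q.hom) := .of_isPreimmersion _ hclosed
  exact ⟨‹_›⟩

end Separated


/-! ### §4 INTERFACE TO THE CHARTED QUOTIENT DATUM (the output of the locally directed gluing, census Q5c, chart-square form) -/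

section ChartedQuotient

variable {S : Scheme.{u}} {G X Q : Over S} (act : G ⊗ X ⟶ X) (π : X ⟶ Q) (w : act ≫ π = snd G X ≫ π)
  {J : Type u} (U : J → X.left.Opens) (a : ∀ j, G ⊗ Over.mk ((U j).ι ≫ X.hom) ⟶ Over.mk ((U j).ι ≫ X.hom))
  (QU : J → Over S) (q : ∀ j, Over.mk ((U j).ι ≫ X.hom) ⟶ QU j) (ιQ : ∀ j, QU j ⟶ Q)
  (hopen : ∀ j, IsOpenImmersion (ιQ j).left) (hcov : ∀ y : ↥Q.left, ∃ j, y ∈ Set.range (ιQ j).left)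
  (hch : ∀ j, IsAffineOpen (U j) ∧
    a j ≫ (Over.homMk (U j).ι : Over.mk ((U j).ι ≫ X.hom) ⟶ X) =
      (G ◁ (Over.homMk (U j).ι : Over.mk ((U j).ι ≫ X.hom) ⟶ X)) ≫ act ∧
    q j ≫ ιQ j = (Over.homMk (U j).ι : Over.mk ((U j).ι ≫ X.hom) ⟶ X) ≫ π ∧
    IsPullback (q j).left (U j).ι (ιQ j).left π.left ∧
    IsAffine (QU j).left ∧ LocallyOfFiniteType (QU j).hom ∧
    IsFinite (q j).left ∧ Flat (q j).left ∧ Surjective (q j).left ∧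
    a j ≫ q j = snd G (Over.mk ((U j).ι ≫ X.hom)) ≫ q j ∧
    IsPullback (a j).left (snd G (Over.mk ((U j).ι ≫ X.hom))).left (q j).left (q j).left)

include hcov in
/-- The charts `ιQ j : QU j → Q` of a charted quotient datum (open immersions, jointly surjective) form an open cover of `Q` — packaged as the
statement that every property of the members of `Scheme.Cover.mkOfCovers` holds; used below through `Scheme.Cover.mkOfCovers` inline. We record the
covering in the form Mathlib's constructor wants. [cite: SGA3I, Exp. V §5] -/
theorem exists_eq_of_charts (y : ↥Q.left) : ∃ (j : J) (z : ↥(QU j).left), (ιQ j).left z = y := by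
  obtain ⟨j, z, hz⟩ := hcov y
  exact ⟨j, z, hz⟩

include w hopen hcov hch in
/-- **GLOBAL TORSOR SQUARE FROM A CHARTED QUOTIENT DATUM, underlying schemes** (Q7 at the census-Q5c interface, chart-square form: for every `j` a
`G`-stable affine open `U j ⊆ X` with a lift `a j` of the action, an affine chart `ιQ j : QU j ↪ Q` (open immersion; jointly surjective) with `U j = X ×_Q QU j`
(chart square) and a finite flat surjective `q j : U j → QU j` over it whose torsor square `G ⊗ U j ≅ U j ×_{QU j} U j` is cartesian):
`IsPullback act.left pr₂.left π.left π.left`. [cite: MumfordAV1970, §12 Theorem 1 (A) and its proof (pp. 111–115)] [cite: SGA3I, Exp. V Thm. 4.1, §5] -/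
theorem isPullback_act_snd_left_of_chartedQuotient : IsPullback act.left (snd G X).left π.left π.left :=
  isPullback_act_snd_left act π w
    (Scheme.Cover.mkOfCovers J (fun j => (QU j).left) (fun j => (ιQ j).left) (exists_eq_of_charts QU ιQ hcov) hopen)
    (fun j => Over.mk ((U j).ι ≫ X.hom)) (fun j => Over.homMk (U j).ι) a (fun j => (hch j).2.1) (fun j => (q j).left)
    (fun j => (hch j).2.2.2.1.flip) (fun j => (hch j).2.2.2.2.2.2.2.2.2.2)

include w hopen hcov hch in
/-- **GLOBAL TORSOR SQUARE FROM A CHARTED QUOTIENT DATUM, in `Over S`** — the `hsq` token of the group-law descent (Q8) and of the kernel-on-points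
computation (Q9). [cite: MumfordAV1970, §12 Theorem 1 (A) and its proof (pp. 111–115)] [cite: SGA3I, Exp. V Thm. 4.1, §5] -/
theorem isPullback_act_snd_of_chartedQuotient : IsPullback act (snd G X) π π :=
  isPullback_of_left (isPullback_act_snd_left_of_chartedQuotient act π w U a QU q ιQ hopen hcov hch)

include hopen hcov hch in
/-- **`π` IS FINITE** for a charted quotient datum (chartwise `IsFinite (q j).left`). [cite: MumfordAV1970, §12 Theorem 1 (pp. 111–115)] -/
theorem isFinite_of_chartedQuotient : IsFinite π.left :=
  isFinite_of_charts π.left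
    (Scheme.Cover.mkOfCovers J (fun j => (QU j).left) (fun j => (ιQ j).left) (exists_eq_of_charts QU ιQ hcov) hopen)
    (fun j => (U j).ι) (fun j => (q j).left) (fun j => (hch j).2.2.2.1.flip) (fun j => (hch j).2.2.2.2.2.2.1)

include hopen hcov hch in
/-- **`π` IS FLAT** for a charted quotient datum. [cite: MumfordAV1970, §12 Theorem 1 (pp. 111–115)] -/
theorem flat_of_chartedQuotient : Flat π.left :=
  flat_of_charts π.left
    (Scheme.Cover.mkOfCovers J (fun j => (QU j).left) (fun j => (ιQ j).left) (exists_eq_of_charts QU ιQ hcov) hopen)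
    (fun j => (U j).ι) (fun j => (q j).left) (fun j => (hch j).2.2.2.1.flip) (fun j => (hch j).2.2.2.2.2.2.2.1)

include hopen hcov hch in
/-- **`π` IS SURJECTIVE** for a charted quotient datum. [cite: MumfordAV1970, §12 Theorem 1 (pp. 111–115)] -/
theorem surjective_of_chartedQuotient : Surjective π.left :=
  surjective_of_charts π.left
    (Scheme.Cover.mkOfCovers J (fun j => (QU j).left) (fun j => (ιQ j).left) (exists_eq_of_charts QU ιQ hcov) hopen)
    (fun j => (U j).ι) (fun j => (q j).left) (fun j => (hch j).2.2.2.1.flip) (fun j => (hch j).2.2.2.2.2.2.2.2.1)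

include hopen hcov hch in
/-- **THE QUOTIENT IS LOCALLY OF FINITE TYPE over `S`** for a charted quotient datum (chartwise `LocallyOfFiniteType (QU j).hom`).
[cite: MumfordAV1970, §12 Theorem 1 (pp. 111–115)] [cite: SGA3I, Exp. V Thm. 4.1] -/
theorem locallyOfFiniteType_of_chartedQuotient : LocallyOfFiniteType Q.hom := by
  refine locallyOfFiniteType_of_charts
    (Scheme.Cover.mkOfCovers J (fun j => (QU j).left) (fun j => (ιQ j).left) (exists_eq_of_charts QU ιQ hcov) hopen) Q.hom fun j => ?_
  change LocallyOfFiniteType ((ιQ j).left ≫ Q.hom)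
  rw [Over.w (ιQ j)]
  exact (hch j).2.2.2.2.2.1

include w hopen hcov hch in
/-- **THE QUOTIENT IS SEPARATED over `S`** for a charted quotient datum whose shear `(act, pr₂) : G ⊗ X → X ⊗_S X` is a closed immersion (free action of a
finite group scheme; the §Q organ (g1) ★ `TranslationAction.isClosedImmersion_lift_act_snd_left`). [cite: MumfordAV1970, §12 Theorem 1 (pp. 111–115)]
[cite: MumfordFogartyKirwan1994, Ch. 0 §3, Def. 0.8 (pp. 9–10)] -/
theorem isSeparated_of_chartedQuotient (hfree : IsClosedImmersion (lift act (snd G X)).left) : IsSeparated Q.hom := by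
  haveI := isFinite_of_chartedQuotient act π U a QU q ιQ hopen hcov hch
  haveI := surjective_of_chartedQuotient act π U a QU q ιQ hopen hcov hch
  exact isSeparated_of_isPullback_of_isClosedImmersion act π (isPullback_act_snd_of_chartedQuotient act π w U a QU q ιQ hopen hcov hch) hfree

end ChartedQuotient

end Literature.AlgebraicGeometry.RelativeSpec.TorsorQuotientGlobal

end
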